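import Summits.ValiantsHypothesis.ValiantsHypothesis.Theorems.FifoMatchingNNDivisionHardLocatedRowsPinExposed
import HarnessLib

/-!
# LOCATED ROWS — part 5/8 — §4c ★ the CLASS «column-coupled affine cubes» (crit-9 N20's single-column negative tilt) is decided by `entryTilted.Law`'s body and by `ExactPencilLaw`'s body

Theorems-side port (staged by val-idea-40 g5 for the desk's P-W6b hand; declaration texts VERBATIM, namespace `…Theorems.FifoMatching.LocatedRows`) of val-idea-40 g5's crux workfile `Cruxes/NNDivisionHard/LocatedRows.lean` REV 5 @4b120a7727c3 (sha16 18e097fc3d9fe11e, 1953 l.; critic of record val-idea-crit-9 g2 VERDICTS #48 / #54 / #58: VERIFIED KEEP, axioms standard), split by the 400-line cap into seven chained modules `…RowFamilies` (§1, §2, §4e-frame) → `…LocatedRowsZeroDiag` (§3) → `…LocatedRowsPairPencil` (§4) → `…LocatedRowsPinExposed` (§4b) → `…LocatedRowsColumnCoupled` (§4c) → `…LocatedRowsPermutahedron` (§4c′, §4d) → `…LocatedRowsCeiling` (§5, §5b).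

* `cubePt`, `dotProduct_cubePt`, `ColumnCoupled`, `colTilt`, `colStrength`, ★★ `columnTilt_block_family` (any row family containing the rows `udRow a + colTilt`, rhs 1), `columnTilt_block`, `entryTilted_law_on_columnCoupled`, `concl_of_lawBody`, `columnCoupled_decided`; `hCOR_colTilt`, `exactTilted_law_on_columnCoupled` (workfile §4e).

HONEST LABEL: helper rows for an OPEN crux (21181 `NNDivisionHard` OPEN; `ExactPencilLaw`, `allRows.Law`, COR-VIRTUAL OPEN); the `Law`s are `Prop`-valued definitions, nothing open is asserted; VP ≠ VNP is NOT proved.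
-/

set_option autoImplicit false

-- the mandated summit-side namespace repeats a component by design (single-problem summit)
set_option linter.dupNamespace false

noncomputable section

open Matrix Finset
open scoped Pointwise

namespace Summit.ValiantsHypothesis.ValiantsHypothesis.Theorems.FifoMatching.LocatedRows

open Literature.Barriers.PneNP (HasEFOfSize three_pow_le_card_mul_two_pow_of_cover_univ)
open Literature.Combinatorics.Optimization.FixedSizePsdRank (Cube bvec flat vecOuter corPolytope flat_dotProduct_vecOuter
  flat_dotProduct_le_of_mem_corPolytope)
open Summit.ValiantsHypothesis.ValiantsHypothesis.Theorems.FifoMatching.XcDivision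
  (udInd udPt udRow udMat udInd_apply udInd_sq udInd_inter ud_data udRow_dotProduct_flat_diagonal flat_dotProduct_flat
    dot_le_of_mem_convexHull)
open Summit.ValiantsHypothesis.Theorems.NNDivisionHardNegative.CliqueRowBlind (sum_udInd_mem sum_udInd_univ)
open Summit.ValiantsHypothesis.ValiantsHypothesis.Theorems.FifoMatching.GridCorShadow (four_T_lt_two_pow)
open Summit.ValiantsHypothesis.Theorems.NNDivisionHardNegative.DiagTilted
  (qOff qOffMat qOff_eq hasEFOfSize_qOff udRow_dotProduct_qOff udInd_compl udInd_univ)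

/-! ## §4c ★ P-W6a — the CLASS «column-coupled affine cubes» is decided by C⁺_entry (N20's single-column negative tilt)

crit-9 g2 N20 (paper): for an AFFINE-CUBE passenger the cheapest located attack is a NEGATIVE tilt supported in ONE column `x₀`,
`W = −Σ_l M_l E_{l x₀}` — box right-hand side `1` (= exact), COR-cost `Σ_l M_l b_l b_{x₀}` vanishing on the window `b ∌ x₀`.
Typed here: the passenger `q_P = flat (Q₀ + Σ_{g∈P} G g)` (`P ⊆ [N]`, generators `G g`), the class `ColumnCoupled G` (a
nonnegative weight `M0` on column `x₀` pairs with every generator's column-`x₀` profile at absolute value `≥ 1` — by rescaling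
and genericity of `M0` in the positive orthant this is «every generator has a nonzero entry in column `x₀`»;
`columnCoupled_of_entry` is the one-entry sufficient condition), and the theorem: under the three hypotheses of `entryTilted.Law`
the rows `(a, −t(a)·Σ_l M0_l E_{l x₀})`, `a ⊆ [n]∖{x₀}`, `t(a) = 1 + Σ_g |⟨udRow a, G g⟩|`, have the COMMON maximiser
`P⋆ = {g : ⟨M0, col_{x₀} G g⟩ < 0}` (`columnTilt_block`), so the block `(a, (b, P⋆))_{a,b ∌ x₀}` is UDISJ_{n−1}:
`3^{n−1} ≤ (r+1)·2^{n−1}`, ★★★ `entryTilted_law_on_columnCoupled` (Law currency, literal `T c n < r`) and, through the pointwise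
Yannakakis step `concl_of_lawBody`, the xc-currency decision ★ `columnCoupled_decided` (the shape a `CoreLaw` binder consumes, flat
socket).  `Q^∘` is a member (`qOff_eq_cubePt`, `columnCoupled_qOff`). -/

section ColumnClass
variable {n N : ℕ}

/-- `flat (A + B) = flat A + flat B`. -/
theorem flat_add' (A B : Matrix (Fin n) (Fin n) ℝ) : flat (A + B) = flat A + flat B := by
  funext p; simp [flat, Matrix.add_apply]

/-- `flat (Σ A_i) = Σ flat A_i`. -/
theorem flat_sum' {ι : Type} (S : Finset ι) (A : ι → Matrix (Fin n) (Fin n) ℝ) :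
    flat (∑ i ∈ S, A i) = ∑ i ∈ S, flat (A i) := by
  classical
  induction S using Finset.induction_on with
  | empty => funext p; simp [flat]
  | insert a S ha ih => rw [Finset.sum_insert ha, Finset.sum_insert ha, flat_add', ih]

/-- `v ⬝ᵥ Σ_{i∈S} f i = Σ_{i∈S} v ⬝ᵥ f i`. -/
theorem dotProduct_finsum' {m : ℕ} {ι : Type} (v : Fin m → ℝ) (S : Finset ι) (w : ι → Fin m → ℝ) :
    v ⬝ᵥ (∑ i ∈ S, w i) = ∑ i ∈ S, v ⬝ᵥ w i := by
  classical
  induction S using Finset.induction_on with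
  | empty => simp
  | insert a S ha ih => rw [Finset.sum_insert ha, Finset.sum_insert ha, dotProduct_add, ih]

/-- AFFINE-CUBE passenger: vertices `q_P = flat (Q₀ + Σ_{g∈P} G g)`, `P ⊆ [N]` (budget `xc ≤ 2N`). -/
def cubePt (Q₀ : Matrix (Fin n) (Fin n) ℝ) (G : Fin N → Matrix (Fin n) (Fin n) ℝ) (P : Finset (Fin N)) :
    Fin (n * n) → ℝ :=
  flat (Q₀ + ∑ g ∈ P, G g)

/-- the value of a functional at a cube vertex splits over the generators in `P`. -/
theorem dotProduct_cubePt (ρ : Fin (n * n) → ℝ) (Q₀ : Matrix (Fin n) (Fin n) ℝ) (G : Fin N → Matrix (Fin n) (Fin n) ℝ)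
    (P : Finset (Fin N)) : ρ ⬝ᵥ cubePt Q₀ G P = ρ ⬝ᵥ flat Q₀ + ∑ g ∈ P, ρ ⬝ᵥ flat (G g) := by
  rw [cubePt, flat_add', flat_sum', dotProduct_add, dotProduct_finsum']

/-- CLASS «COLUMN-COUPLED» (N20, typed): some column `x₀` and a nonnegative weight `M0` on its entries pair with EVERY
generator's column-`x₀` profile at absolute value `≥ 1`. -/
def ColumnCoupled (G : Fin N → Matrix (Fin n) (Fin n) ℝ) : Prop :=
  ∃ (x₀ : Fin n) (M0 : Fin n → ℝ), (∀ l, 0 ≤ M0 l) ∧ ∀ g, 1 ≤ |∑ l, M0 l * G g l x₀|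

/-- one-entry sufficient condition: an entry `(l₀, x₀)` moved by every generator (by at least `1` in absolute value). -/
theorem columnCoupled_of_entry {G : Fin N → Matrix (Fin n) (Fin n) ℝ} (x₀ l₀ : Fin n) (h : ∀ g, 1 ≤ |G g l₀ x₀|) :
    ColumnCoupled G := by
  classical
  refine ⟨x₀, fun l => if l = l₀ then 1 else 0, fun l => ?_, fun g => ?_⟩
  · show (0 : ℝ) ≤ (if l = l₀ then (1 : ℝ) else 0)
    split_ifs <;> norm_num
  simp only [ite_mul, one_mul, zero_mul, Finset.sum_ite_eq', Finset.mem_univ, if_true]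
  exact h g

/-- the single-column negative tilt `W = −Σ_l M_l E_{l x₀}`. -/
def colTilt (x₀ : Fin n) (M : Fin n → ℝ) : Matrix (Fin n) (Fin n) ℝ := fun p q => if q = x₀ then -M p else 0

/-- its COR-cost vanishes on the window `b ∌ x₀`. -/
theorem colTilt_dotProduct_udPt (x₀ : Fin n) (M : Fin n → ℝ) {b : Finset (Fin n)} (hb : x₀ ∉ b) :
    flat (colTilt x₀ M) ⬝ᵥ udPt b = 0 := by
  have hx : udInd b x₀ = 0 := by rw [udInd_apply, if_neg hb]
  rw [show udPt b = vecOuter n (udInd b) from rfl, flat_dotProduct_vecOuter]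
  refine Finset.sum_eq_zero fun i _ => Finset.sum_eq_zero fun j _ => ?_
  by_cases hj : j = x₀
  · subst hj; rw [hx]; ring
  · simp [colTilt, hj]

/-- its pairing with a generator: `−Σ_l M_l G_{l x₀}`. -/
theorem colTilt_dotProduct_flat (x₀ : Fin n) (M : Fin n → ℝ) (A : Matrix (Fin n) (Fin n) ℝ) :
    flat (colTilt x₀ M) ⬝ᵥ flat A = -∑ l, M l * A l x₀ := by
  rw [flat_dotProduct_flat]
  have h : ∀ i, ∑ j, colTilt x₀ M i j * A i j = -(M i * A i x₀) := fun i => by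
    rw [Finset.sum_eq_single x₀ (fun j _ hj => by simp [colTilt, hj]) (fun h => absurd (Finset.mem_univ _) h)]
    simp [colTilt]
  simp_rw [h, Finset.sum_neg_distrib]

/-- its box right-hand side is `0` (`M ≥ 0`): the box rhs of a negative tilt is EXACT. -/
theorem box_colTilt (x₀ : Fin n) (M : Fin n → ℝ) (hM : ∀ l, 0 ≤ M l) : ∑ p, ∑ q, max (colTilt x₀ M p q) 0 = 0 := by
  refine Finset.sum_eq_zero fun p _ => Finset.sum_eq_zero fun q _ => ?_
  unfold colTilt
  split_ifs
  · exact max_eq_right (neg_nonpos.mpr (hM p))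
  · exact max_self 0

/-- the row-dependent TILT STRENGTH `t(a) = 1 + Σ_g |⟨udRow a, G_g⟩|` of the column-tilt certificate (it dominates the
clique part's own profile on the cube, so that the column term decides the sign of every generator for every row). -/
def colStrength (G : Fin N → Matrix (Fin n) (Fin n) ℝ) (a : Finset (Fin n)) : ℝ := 1 + ∑ g, |udRow a ⬝ᵥ flat (G g)|

/-- `colStrength G a > 0`. -/
theorem colStrength_pos (G : Fin N → Matrix (Fin n) (Fin n) ℝ) (a : Finset (Fin n)) : 0 < colStrength G a := by
  unfold colStrength; positivity

/-- ★★ **THE COLUMN-TILT BLOCK, FAMILY-AGNOSTIC FORM** (N20 in kernel): for ANY row family `F` containing, for every clique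
row `a`, a row `row a` with functional `udRow a − t(a)·Σ_l M0_l E_{l x₀}` and right-hand side `1` (box rhs AND exact rhs of
the nonpositive column tilt are both `0`), the three hypotheses of `F.Law` at a column-coupled affine cube force
`3^{n−1} ≤ (r+1)·2^{n−1}` — the window `b ∌ x₀` has zero tilt cost, `P⋆ = {g : s_g < 0}` maximises every row, and the block
`(a ⊆ [n]∖{x₀}) × ((b, P⋆) : b ⊆ [n]∖{x₀})` of the augmented slack is `(1 − |a∩b|)²`. -/
theorem columnTilt_block_family (F : RowFamily) {K r : ℕ} (Q₀ : Matrix (Fin n) (Fin n) ℝ)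
    (G : Fin N → Matrix (Fin n) (Fin n) ℝ)
    (x₀ : Fin n) (M0 : Fin n → ℝ) (hs : ∀ g, 1 ≤ |∑ l, M0 l * G g l x₀|)
    (e : Fin (K + 1) → Finset (Fin N)) (he : Function.Surjective e)
    (row : Finset (Fin n) → F.A n)
    (hρ : ∀ a, F.ρ n (row a) = udRow a + flat (colTilt x₀ fun l => colStrength G a * M0 l))
    (hβ : ∀ a, F.β n (row a) = 1)
    (mm : F.A n → ℝ)
    (hle : ∀ a j, F.ρ n a ⬝ᵥ (cubePt Q₀ G ∘ e) j ≤ mm a)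
    (hat : ∀ a, ∃ j, F.ρ n a ⬝ᵥ (cubePt Q₀ G ∘ e) j = mm a)
    (U : F.A n → Option (Fin r) → ℝ) (V : Finset (Fin n) × Fin (K + 1) → Option (Fin r) → ℝ)
    (hU : ∀ a i, 0 ≤ U a i) (hV : ∀ p i, 0 ≤ V p i)
    (hfac : ∀ a b j, (F.β n a + mm a) - F.ρ n a ⬝ᵥ (udPt b + (cubePt Q₀ G ∘ e) j)
      = ∑ i, U a i * V (b, j) i) :
    3 ^ (n - 1) ≤ (r + 1) * 2 ^ (n - 1) := by
  classical
  -- data: signed profiles, the common column, the row-dependent tilt strength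
  let s : Fin N → ℝ := fun g => ∑ l, M0 l * G g l x₀
  let Pstar : Finset (Fin N) := Finset.univ.filter fun g => s g < 0
  obtain ⟨jstar, hGe⟩ := he Pstar
  let cc : Finset (Fin n) → Fin N → ℝ := fun a g => udRow a ⬝ᵥ flat (G g)
  let t : Finset (Fin n) → ℝ := fun a => colStrength G a
  let W : Finset (Fin n) → Matrix (Fin n) (Fin n) ℝ := fun a => colTilt x₀ fun l => t a * M0 l
  have hρW : ∀ a, F.ρ n (row a) = udRow a + flat (W a) := hρ
  let G₀ : Finset (Fin n) := ({x₀} : Finset (Fin n))ᶜ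
  let α := {x : Fin n // x ∈ G₀}
  have hcardα : Fintype.card α = n - 1 := by
    rw [Fintype.card_coe, Finset.card_compl, Finset.card_singleton, Fintype.card_fin]
  let emb : α ↪ Fin n := Function.Embedding.subtype _
  let col : Finset α → Finset (Fin n) × Fin (K + 1) := fun b' => (b'.map emb, jstar)
  have hx₀ : ∀ b' : Finset α, x₀ ∉ b'.map emb := fun b' hx => by
    obtain ⟨y, -, hy⟩ := Finset.mem_map.1 hx
    have hy' : (y : Fin n) = x₀ := hy
    have := y.2
    rw [Finset.mem_compl, Finset.mem_singleton] at this
    exact this hy'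
  have ht0 : ∀ a, 0 ≤ t a := fun a => (colStrength_pos G a).le
  have htdef : ∀ a, t a = 1 + ∑ g', |cc a g'| := fun a => rfl
  -- the value of row `a` at the cube vertex `P`
  have hWg : ∀ a g, flat (W a) ⬝ᵥ flat (G g) = -(t a * s g) := fun a g => by
    show flat (colTilt x₀ fun l => t a * M0 l) ⬝ᵥ flat (G g) = _
    rw [colTilt_dotProduct_flat]
    simp only [s, Finset.mul_sum, mul_assoc]
  have hv : ∀ a P, (udRow a + flat (W a)) ⬝ᵥ cubePt Q₀ G P
      = (udRow a + flat (W a)) ⬝ᵥ flat Q₀ + ∑ g ∈ P, (cc a g - t a * s g) := fun a P => by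
    rw [dotProduct_cubePt]
    congr 1
    refine Finset.sum_congr rfl fun g _ => ?_
    rw [add_dotProduct, hWg]
    ring
  -- signs: `P⋆` collects exactly the generators with positive coefficient, for EVERY row
  have hpos : ∀ a, ∀ g ∈ Pstar, 0 ≤ cc a g - t a * s g := fun a g hg => by
    have hsg : s g < 0 := (Finset.mem_filter.1 hg).2
    have h1 : 1 ≤ |s g| := hs g
    have hs1 : s g ≤ -1 := by rw [abs_of_neg hsg] at h1; linarith
    have hc : |cc a g| ≤ ∑ g', |cc a g'| :=
      Finset.single_le_sum (f := fun g' => |cc a g'|) (fun g' _ => abs_nonneg (cc a g')) (Finset.mem_univ g)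
    have hc' : -cc a g ≤ |cc a g| := neg_le_abs (cc a g)
    have hts : t a * s g ≤ -(t a) := by
      have := mul_le_mul_of_nonneg_left hs1 (ht0 a); linarith
    have := htdef a
    linarith
  have hneg : ∀ a, ∀ g ∉ Pstar, cc a g - t a * s g ≤ 0 := fun a g hg => by
    have hsg : 0 ≤ s g := not_lt.1 fun h => hg (Finset.mem_filter.2 ⟨Finset.mem_univ _, h⟩)
    have h1 : 1 ≤ |s g| := hs g
    have hs1 : 1 ≤ s g := by rwa [abs_of_nonneg hsg] at h1
    have hc : |cc a g| ≤ ∑ g', |cc a g'| :=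
      Finset.single_le_sum (f := fun g' => |cc a g'|) (fun g' _ => abs_nonneg (cc a g')) (Finset.mem_univ g)
    have hc' : cc a g ≤ |cc a g| := le_abs_self _
    have hts : t a ≤ t a * s g := by
      have := mul_le_mul_of_nonneg_left hs1 (ht0 a); linarith
    have := htdef a
    linarith
  -- hence `P⋆` maximises every row
  have hmaxP : ∀ a P, (udRow a + flat (W a)) ⬝ᵥ cubePt Q₀ G P ≤ (udRow a + flat (W a)) ⬝ᵥ cubePt Q₀ G Pstar := by
    intro a P
    rw [hv a P, hv a Pstar]
    refine add_le_add (le_refl _) ?_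
    calc ∑ g ∈ P, (cc a g - t a * s g)
        = ∑ g ∈ P.filter (· ∈ Pstar), (cc a g - t a * s g) + ∑ g ∈ P.filter (· ∉ Pstar), (cc a g - t a * s g) :=
          (Finset.sum_filter_add_sum_filter_not P (· ∈ Pstar) _).symm
      _ ≤ ∑ g ∈ P.filter (· ∈ Pstar), (cc a g - t a * s g) := by
          have : ∑ g ∈ P.filter (· ∉ Pstar), (cc a g - t a * s g) ≤ 0 :=
            Finset.sum_nonpos fun g hg => hneg a g (Finset.mem_filter.1 hg).2
          linarith
      _ ≤ ∑ g ∈ Pstar, (cc a g - t a * s g) :=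
          Finset.sum_le_sum_of_subset_of_nonneg (fun g hg => (Finset.mem_filter.1 hg).2) fun g hg _ => hpos a g hg
  -- the block
  obtain ⟨-, -, slack, -⟩ := ud_data n
  have key := three_pow_le_of_block (ι := Option (Fin r)) U V hU hV (fun a' => row (a'.map emb)) col ?_
  · rw [hcardα, Fintype.card_option, Fintype.card_fin] at key; exact key
  intro a' b'
  show ∑ i, U (row (a'.map emb)) i * V (b'.map emb, jstar) i = _
  rw [← hfac (row (a'.map emb)) (b'.map emb) jstar]
  have hm : mm (row (a'.map emb)) = (udRow (a'.map emb) + flat (W (a'.map emb))) ⬝ᵥ cubePt Q₀ G Pstar := by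
    obtain ⟨j₀, hj₀⟩ := hat (row (a'.map emb))
    have h1 : (udRow (a'.map emb) + flat (W (a'.map emb))) ⬝ᵥ cubePt Q₀ G (e j₀) = mm (row (a'.map emb)) := by
      rw [← hρW]; exact hj₀
    have h2 : (udRow (a'.map emb) + flat (W (a'.map emb))) ⬝ᵥ cubePt Q₀ G (e jstar) ≤ mm (row (a'.map emb)) := by
      rw [← hρW]; exact hle (row (a'.map emb)) jstar
    rw [hGe] at h2
    have h3 := hmaxP (a'.map emb) (e j₀)
    rw [h1] at h3
    exact le_antisymm h3 h2
  have hud : udRow (a'.map emb) ⬝ᵥ udPt (b'.map emb) = 1 - (1 - (((a' ∩ b').card : ℕ) : ℝ)) ^ 2 := by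
    have := slack (a'.map emb) (b'.map emb)
    rw [← Finset.map_inter, Finset.card_map] at this
    linarith
  have hWb : flat (W (a'.map emb)) ⬝ᵥ udPt (b'.map emb) = 0 := colTilt_dotProduct_udPt x₀ _ (hx₀ b')
  rw [hβ, hρW, hm, Function.comp_apply, hGe,
    dotProduct_add (udRow (a'.map emb) + flat (W (a'.map emb))) (udPt (b'.map emb)) (cubePt Q₀ G Pstar),
    add_dotProduct (udRow (a'.map emb)) (flat (W (a'.map emb))) (udPt (b'.map emb)), hud, hWb]
  ring

/-- ★★ **THE COLUMN-TILT BLOCK** (N20 in kernel, Law currency) for `entryTilted` (= C⁺_entry, box right-hand side): the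
rows `(a, −t(a)·Σ_l M0_l E_{l x₀})` have box rhs `1`. -/
theorem columnTilt_block {K r : ℕ} (Q₀ : Matrix (Fin n) (Fin n) ℝ) (G : Fin N → Matrix (Fin n) (Fin n) ℝ)
    (x₀ : Fin n) (M0 : Fin n → ℝ) (hM : ∀ l, 0 ≤ M0 l) (hs : ∀ g, 1 ≤ |∑ l, M0 l * G g l x₀|)
    (e : Fin (K + 1) → Finset (Fin N)) (he : Function.Surjective e) (mm : entryTilted.A n → ℝ)
    (hle : ∀ a j, entryTilted.ρ n a ⬝ᵥ (cubePt Q₀ G ∘ e) j ≤ mm a)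
    (hat : ∀ a, ∃ j, entryTilted.ρ n a ⬝ᵥ (cubePt Q₀ G ∘ e) j = mm a)
    (U : entryTilted.A n → Option (Fin r) → ℝ) (V : Finset (Fin n) × Fin (K + 1) → Option (Fin r) → ℝ)
    (hU : ∀ a i, 0 ≤ U a i) (hV : ∀ p i, 0 ≤ V p i)
    (hfac : ∀ a b j, (entryTilted.β n a + mm a) - entryTilted.ρ n a ⬝ᵥ (udPt b + (cubePt Q₀ G ∘ e) j)
      = ∑ i, U a i * V (b, j) i) :
    3 ^ (n - 1) ≤ (r + 1) * 2 ^ (n - 1) := by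
  refine columnTilt_block_family entryTilted Q₀ G x₀ M0 hs e he
    (fun a => (a, colTilt x₀ fun l => colStrength G a * M0 l)) (fun a => rfl) (fun a => ?_) mm hle hat U V hU hV hfac
  show 1 + ∑ p, ∑ q, max (colTilt x₀ (fun l => colStrength G a * M0 l) p q) 0 = 1
  rw [box_colTilt x₀ _ (fun l => mul_nonneg (colStrength_pos G a).le (hM l)), add_zero]

/-- ★★★ **C⁺_entry HOLDS ON COLUMN-COUPLED AFFINE CUBES** — `entryTilted.Law` (= `LocatedPencilLaw`) with its passenger
quantifier restricted to (any listing of) a column-coupled affine cube: literal conclusion `T c n < r`. -/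
theorem entryTilted_law_on_columnCoupled : ∀ c : ℕ, ∃ n₀ : ℕ, ∀ n ≥ n₀,
    ∀ (N K : ℕ) (Q₀ : Matrix (Fin n) (Fin n) ℝ) (G : Fin N → Matrix (Fin n) (Fin n) ℝ)
      (e : Fin (K + 1) → Finset (Fin N)) (r : ℕ), Function.Surjective e → ColumnCoupled G →
    HasEFOfSize (convexHull ℝ (Set.range (cubePt Q₀ G ∘ e))) r →
    ∀ mm : entryTilted.A n → ℝ, (∀ a j, entryTilted.ρ n a ⬝ᵥ (cubePt Q₀ G ∘ e) j ≤ mm a) →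
      (∀ a, ∃ j, entryTilted.ρ n a ⬝ᵥ (cubePt Q₀ G ∘ e) j = mm a) →
    ∀ (U : entryTilted.A n → Option (Fin r) → ℝ) (V : Finset (Fin n) × Fin (K + 1) → Option (Fin r) → ℝ),
      (∀ a i, 0 ≤ U a i) → (∀ p i, 0 ≤ V p i) →
      (∀ a b j, (entryTilted.β n a + mm a) - entryTilted.ρ n a ⬝ᵥ (udPt b + (cubePt Q₀ G ∘ e) j)
        = ∑ i, U a i * V (b, j) i) →
      T c n < r := by
  intro c
  obtain ⟨n₀, hn₀⟩ := T_lt_of_block' c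
  refine ⟨max n₀ 2, fun n hn N K Q₀ G e r he hcc _ mm hle hat U V hU hV hfac => ?_⟩
  obtain ⟨x₀, M0, hM, hs⟩ := hcc
  have h2 : 2 ≤ n := le_of_max_le_right hn
  exact hn₀ n (le_of_max_le_left hn) (n - 1) r (by omega)
    (columnTilt_block Q₀ G x₀ M0 hM hs e he mm hle hat U V hU hV hfac)

/-- ★ POINTWISE YANNAKAKIS (the body of `corVirtualHardN_of_law` at one passenger and one size): if the `F`-Law's body holds at
`(q, r)` with any conclusion `C`, then an EF of `COR(n) + conv q` of size `r` gives `C`. -/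
theorem concl_of_lawBody (F : RowFamily) {n K r : ℕ} (q : Fin (K + 1) → (Fin (n * n) → ℝ)) {C : Prop}
    (hbody : ∀ m : F.A n → ℝ, (∀ a j, F.ρ n a ⬝ᵥ q j ≤ m a) → (∀ a, ∃ j, F.ρ n a ⬝ᵥ q j = m a) →
      ∀ (U : F.A n → Option (Fin r) → ℝ) (V : Finset (Fin n) × Fin (K + 1) → Option (Fin r) → ℝ),
        (∀ a i, 0 ≤ U a i) → (∀ p i, 0 ≤ V p i) →
        (∀ a b j, (F.β n a + m a) - F.ρ n a ⬝ᵥ (udPt b + q j) = ∑ i, U a i * V (b, j) i) → C)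
    (hR : HasEFOfSize (corPolytope n + convexHull ℝ (Set.range q)) r) : C := by
  classical
  obtain ⟨pt_mem, -, -, -⟩ := ud_data n
  let m : F.A n → ℝ := fun a =>
    Finset.univ.sup' Finset.univ_nonempty (fun j : Fin (K + 1) => F.ρ n a ⬝ᵥ q j)
  have hmax : ∀ a, ∃ j, F.ρ n a ⬝ᵥ q j = m a := fun a => by
    obtain ⟨j, -, hj⟩ := Finset.exists_mem_eq_sup' Finset.univ_nonempty
      (fun j : Fin (K + 1) => F.ρ n a ⬝ᵥ q j)
    exact ⟨j, hj.symm⟩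
  have hmq : ∀ a j, F.ρ n a ⬝ᵥ q j ≤ m a := fun a j =>
    Finset.le_sup' (fun j : Fin (K + 1) => F.ρ n a ⬝ᵥ q j) (Finset.mem_univ j)
  have hm : ∀ a, ∀ y ∈ convexHull ℝ (Set.range q), F.ρ n a ⬝ᵥ y ≤ m a := fun a =>
    dot_le_of_mem_convexHull _ _ _ (by rintro _ ⟨j, rfl⟩; exact hmq a j)
  have hq : ∀ j, q j ∈ convexHull ℝ (Set.range q) := fun j => subset_convexHull ℝ _ ⟨j, rfl⟩
  have hv : ∀ p : Finset (Fin n) × Fin (K + 1),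
      udPt p.1 + q p.2 ∈ corPolytope n + convexHull ℝ (Set.range q) :=
    fun p => Set.add_mem_add (pt_mem p.1) (hq p.2)
  have hvalid : ∀ a, ∀ x ∈ corPolytope n + convexHull ℝ (Set.range q), F.ρ n a ⬝ᵥ x ≤ F.β n a + m a := by
    rintro a x ⟨p, hp, y, hy, rfl⟩
    rw [dotProduct_add]
    exact add_le_add (F.valid n a p hp) (hm a y hy)
  obtain ⟨U, V, hU, hV, hfac⟩ := Literature.Barriers.PneNP.HasEFOfSize.exists_nonneg_factorization hR
    (fun p : Finset (Fin n) × Fin (K + 1) => udPt p.1 + q p.2) hv (F.ρ n) (fun a => F.β n a + m a) hvalid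
  exact hbody m hmq hmax U V hU hV (fun a b j => hfac a (b, j))

/-- ★ **COLUMN-COUPLED AFFINE CUBES ARE DECIDED** (xc currency, flat socket — the shape a `CoreLaw` binder consumes):
`HasEFOfSize (COR(n) + conv q) r ⟹ T c n < r`, eventually in `n`, for every listing `q` of a column-coupled affine cube. -/
theorem columnCoupled_decided : ∀ c : ℕ, ∃ n₀ : ℕ, ∀ n ≥ n₀,
    ∀ (N K : ℕ) (Q₀ : Matrix (Fin n) (Fin n) ℝ) (G : Fin N → Matrix (Fin n) (Fin n) ℝ)
      (e : Fin (K + 1) → Finset (Fin N)) (r : ℕ), Function.Surjective e → ColumnCoupled G →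
    HasEFOfSize (corPolytope n + convexHull ℝ (Set.range (cubePt Q₀ G ∘ e))) r → T c n < r := by
  intro c
  obtain ⟨n₀, hn₀⟩ := T_lt_of_block' c
  refine ⟨max n₀ 2, fun n hn N K Q₀ G e r he hcc hR => ?_⟩
  obtain ⟨x₀, M0, hM, hs⟩ := hcc
  have h2 : 2 ≤ n := le_of_max_le_right hn
  refine concl_of_lawBody entryTilted (cubePt Q₀ G ∘ e) (fun mm hle hat U V hU hV hfac => ?_) hR
  exact hn₀ n (le_of_max_le_left hn) (n - 1) r (by omega)
    (columnTilt_block Q₀ G x₀ M0 hM hs e he mm hle hat U V hU hV hfac)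

/-- ★ likewise **PIN-EXPOSED PASSENGERS ARE DECIDED** (xc currency, flat socket). -/
theorem pinExposed_decided : ∀ c : ℕ, ∃ n₀ : ℕ, ∀ n ≥ n₀,
    ∀ (K : ℕ) (q : Fin (K + 1) → (Fin (n * n) → ℝ)) (r : ℕ), PinExposed n K q →
    HasEFOfSize (corPolytope n + convexHull ℝ (Set.range q)) r → T c n < r := by
  intro c
  obtain ⟨n₀, hn₀⟩ := T_lt_of_block' c
  refine ⟨n₀, fun n hn K q r hpin hR => ?_⟩
  obtain ⟨S, w, jstar, hS, hvalid, htight, hmax⟩ := hpin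
  refine concl_of_lawBody pinnedRows q (fun mm hle hat U V hU hV hfac => ?_) hR
  exact hn₀ n hn (n - S.card) r (by omega) (pin_block q S w jstar hvalid htight hmax mm hle hat U V hU hV hfac)


/-- the exact support value of a nonpositive column tilt is `0` (attained at `b = ∅`). -/
theorem hCOR_colTilt (x₀ : Fin n) (M : Fin n → ℝ) (hM : ∀ l, 0 ≤ M l) : hCOR (colTilt x₀ M) = 0 := by
  refine le_antisymm ?_ ?_
  · have := hCOR_le_box (colTilt x₀ M)
    rwa [box_colTilt x₀ M hM] at this
  · have := le_hCOR (colTilt x₀ M) ∅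
    rwa [colTilt_dotProduct_udPt x₀ M (Finset.notMem_empty x₀)] at this

/-- ★★★ **`ExactPencilLaw`'s body HOLDS ON COLUMN-COUPLED AFFINE CUBES** (N20's class in the law-of-record currency). -/
theorem exactTilted_law_on_columnCoupled : ∀ c : ℕ, ∃ n₀ : ℕ, ∀ n ≥ n₀,
    ∀ (N K : ℕ) (Q₀ : Matrix (Fin n) (Fin n) ℝ) (G : Fin N → Matrix (Fin n) (Fin n) ℝ)
      (e : Fin (K + 1) → Finset (Fin N)) (r : ℕ), Function.Surjective e → ColumnCoupled G →
    HasEFOfSize (convexHull ℝ (Set.range (cubePt Q₀ G ∘ e))) r →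
    ∀ mm : exactTilted.A n → ℝ, (∀ a j, exactTilted.ρ n a ⬝ᵥ (cubePt Q₀ G ∘ e) j ≤ mm a) →
      (∀ a, ∃ j, exactTilted.ρ n a ⬝ᵥ (cubePt Q₀ G ∘ e) j = mm a) →
    ∀ (U : exactTilted.A n → Option (Fin r) → ℝ) (V : Finset (Fin n) × Fin (K + 1) → Option (Fin r) → ℝ),
      (∀ a i, 0 ≤ U a i) → (∀ p i, 0 ≤ V p i) →
      (∀ a b j, (exactTilted.β n a + mm a) - exactTilted.ρ n a ⬝ᵥ (udPt b + (cubePt Q₀ G ∘ e) j)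
        = ∑ i, U a i * V (b, j) i) →
      T c n < r := by
  intro c
  obtain ⟨n₀, hn₀⟩ := T_lt_of_block' c
  refine ⟨max n₀ 2, fun n hn N K Q₀ G e r he hcc _ mm hle hat U V hU hV hfac => ?_⟩
  obtain ⟨x₀, M0, hM, hs⟩ := hcc
  have h2 : 2 ≤ n := le_of_max_le_right hn
  refine hn₀ n (le_of_max_le_left hn) (n - 1) r (by omega)
    (columnTilt_block_family exactTilted Q₀ G x₀ M0 hs e he
      (fun a => (a, colTilt x₀ fun l => colStrength G a * M0 l)) (fun a => rfl) (fun a => ?_) mm hle hat U V hU hV hfac)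
  show 1 + hCOR (colTilt x₀ fun l => colStrength G a * M0 l) = 1
  rw [hCOR_colTilt x₀ _ (fun l => mul_nonneg (colStrength_pos G a).le (hM l)), add_zero]

end ColumnClass

end Summit.ValiantsHypothesis.ValiantsHypothesis.Theorems.FifoMatching.LocatedRows
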